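import Summits.Schanuel.Schanuel.Theses.DiophantineCore
import Literature.NumberTheory.Transcendental.SchanuelEclEmptyProofs
import HarnessLib

/-!
# Line `birth` — birth skeleton for crux `SchanuelUnderTH` (stmt-Schanuel-3816)

Crux (route DiophantineCore #3, rank 3): **Schanuel's conjecture for separated tuples** — if
`x ∈ ℂⁿ` is `ℚ`-linearly independent and satisfies the Technical Hypothesis (T.H.) of
NesterenkoPhilippon2001 Ch. 14 Def. 2.6, then `trdeg_ℚ ℚ(x, eˣ) ≥ n`.

## The cut (planner skeleton registrar, 2026-08-17): the TRANSCENDENCE-TYPE CUT on Kirby's core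

Lang's notion of *type of transcendence* (Chudnovsky1984 Ch. 1, PDF p. 25 Def. 2, PDF p. 36 "Lang's
scheme"; Waldschmidt, *Nombres transcendants* §4.1): a point `ω ∈ ℂᵐ` has type `≤ τ` if
`|Q(ω)| ≥ exp(−c·t(Q)^τ)` for every integer polynomial `Q` with `Q(ω) ≠ 0`, `t(Q) = deg Q +
log H(Q)` (here `HasTranscendenceType`, with the harmless normalisation
`t(Q) = 1 + deg Q + log(1 + H(Q)) ≥ 1`). Dirichlet's box principle gives type `≥ trdeg + 1`
always (Chudnovsky PDF p. 25, "τ ≥ n+1 by Lemma 1"); the classical conjecture (ibid. PDF p. 26) is that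
generic points have type `≤ trdeg + 1 + ε`.

* stub **CORE FINITE TYPE** `stub_coreFiniteType` (OPEN, Diophantine): every tuple `x` of
  exponential-algebraic numbers (integer Khovanskii coordinates — the route's inlined rendering of
  Kirby's countable core `ecl ∅`, byte-identical with crux `THOnExpAlgebraic`) generates a point
  `(x, eˣ)` of type `< t + 2` whenever `trdeg ℚ(x, eˣ) ≤ t` (the classical conjecture predicts
  the Dirichlet exponent `t + 1 + ε`): core points are Diophantinely generic. This is the
  POLYNOMIAL-level sibling of the route's crux A (`THOnExpAlgebraic` is its linear shadow:
  `th_of_hasTranscendenceType` below, proved; indeed stub ⇒ crux A,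
  `thOnExpAlgebraic_of_coreFiniteType`), i.e.
  Lang–Chudnovsky's finite-type programme restricted to the core, where no Liouville phenomenon is
  known. Not a consequence of Schanuel.
* stub **TYPE GAP UNDER T.H.** `stub_typeGapUnderTH` (OPEN, transcendence): for `n ≥ 1` and a
  `ℚ`-linearly independent `x ∈ ℂⁿ` satisfying T.H., the point `(x, eˣ)` has type `≥ n + 1`
  (for every `τ < n + 1` and `c > 0` some integer `Q` has `0 < |Q(x, eˣ)| < exp(−c t(Q)^τ)`).
  Implied by Schanuel's conclusion at `x` (Dirichlet); its content is the case `trdeg < n`, where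
  it asserts abnormally small NONZERO values at `(x, eˣ)` — the quantitative output of an
  auxiliary-function argument on the node set `{h·x}`, whose zero estimate is exactly where T.H.
  is consumed (tree: `ZeroEstimateFromTH`, Prop. 3.6 "T.H. ⇒ Z.E."). `n = 1` is
  Hermite–Lindemann + Dirichlet.

`SchanuelUnderTH_of (h₁ : Statement.stub_coreFiniteType) (h₂ : Statement.stub_typeGapUnderTH) :
DiophantineCore.SchanuelUnderTH` (sorry-free): by Kirby's PROVED reduction
`schanuelConjecture_iff_ecl_empty_holds` it suffices to treat `ℚ`-linearly independent core
tuples `x ∈ Eⁿ`, `n = k + 1`; if `trdeg ℚ(x, eˣ) ≤ k` then CORE FINITE TYPE gives some type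
`τ < k + 2` (w.l.o.g. `τ ≥ 0`, `HasTranscendenceType.mono`), hence T.H. for `x` (linear shadow,
`th_of_hasTranscendenceType`: `c·(2 + log(1+H))^τ ≤ H^ε` for large `H`,
`isLittleO_log_rpow_rpow_atTop`), and TYPE GAP UNDER T.H. forbids every type `< n + 1 = k + 2` —
contradiction. HONEST DISCLOSURE: the two stubs prove the summit on
the way (`schanuel_of_stubs`); the T.H. hypothesis of the crux is consumed on the core (where stub 1
supplies it), not at the original tuple — no known mechanism consumes T.H.(x) alone for the
`ℓ = 1` grid (barrier `LargeTranscendenceDegree`: every T.H.-conditional theorem needs `d, ℓ ≥ 2`).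

Disproof used: none on file (`ledger crux ls stmt-Schanuel-3816`: no workfiles, 2026-08-17).
-/

set_option linter.dupNamespace false

noncomputable section

namespace Summit.Schanuel.Schanuel.Cruxes.SchanuelUnderTH.Birth

open scoped BigOperators
open Summit.Schanuel.Schanuel.Theses.DiophantineCore (SchanuelUnderTH THOnExpAlgebraic)

/-! ### Lang's type of transcendence (size, height) -/

/-- Naive height of an integer polynomial: the maximum of the absolute values of its coefficients
(`0` for the zero polynomial). [cite: Chudnovsky1984, Ch. 1 §1 Def. 1.2 (PDF p. 37)] -/
def polyHeight {σ : Type*} (Q : MvPolynomial σ ℤ) : ℕ :=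
  Q.support.sup fun m => (Q.coeff m).natAbs

/-- Lang's size `t(Q) = deg Q + log H(Q)`, normalised to be `≥ 1`:
`1 + deg Q + log (1 + H(Q))`. [cite: Chudnovsky1984, Ch. 1 Def. 2 (PDF p. 25)] -/
def polySize {σ : Type*} (Q : MvPolynomial σ ℤ) : ℝ :=
  1 + (Q.totalDegree : ℝ) + Real.log (1 + (polyHeight Q : ℝ))

/-- **Type of transcendence `≤ τ`** of a point `ω ∈ ℂ^σ` (Lang; Chudnovsky1984 Ch. 1 Def. 2, PDF p. 25,
relative form: only polynomials not vanishing at `ω` are constrained, so that algebraically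
dependent `ω` — such as `(x, eˣ)` — are allowed): there is `c > 0` with
`|Q(ω)| ≥ exp(−c · t(Q)^τ)` for every `Q ∈ ℤ[X_σ]` with `Q(ω) ≠ 0`.
[cite: Chudnovsky1984, Ch. 1 Def. 2 (PDF p. 25)] -/
def HasTranscendenceType {σ : Type*} (ω : σ → ℂ) (τ : ℝ) : Prop :=
  ∃ c : ℝ, 0 < c ∧ ∀ Q : MvPolynomial σ ℤ, MvPolynomial.aeval ω Q ≠ 0 →
    Real.exp (-(c * polySize Q ^ τ)) ≤ ‖MvPolynomial.aeval ω Q‖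

/-! ### Registered stubs -/

/-- Stub **CORE FINITE TYPE** (Lang–Chudnovsky finite-type programme on Kirby's countable core):
every tuple `x` of exponential-algebraic numbers (each `xᵢ` an integer Khovanskii coordinate, the
route's inlined rendering of `ecl ∅`, byte-identical with crux `THOnExpAlgebraic`) with
`trdeg_ℚ ℚ(x, eˣ) ≤ t` generates a point `(x, eˣ)` of transcendence type `< t + 2` (some
`τ < t + 2`; Dirichlet forces `τ ≥ trdeg + 1`, and the classical conjecture — Chudnovsky1984 Ch. 1,
PDF p. 26 — predicts every `τ > trdeg + 1`). OPEN: `x = (1)` asks for type `< 3` of `e` (known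
`≤ 3 + ε`, Chudnovsky1984 PDF p. 26); `x = (log 2)` likewise (known `3 + ε`, Fel'dman–Cijsouw); the
instance `x = (iπ)` is TRUE (Fel'dman: `π` has type `≤ 2 + ε`). The polynomial-level sibling of
`THOnExpAlgebraic` (which it implies: `thOnExpAlgebraic_of_coreFiniteType`). NOT refutable by the
Liouville-type tuples that kill its extension to all T.H. tuples (continued-fraction splicing,
Bugeaud2004 PDF p. 165 and Ex. 7.3 (PDF p. 169), gives `ξ` with bounded partial quotients and quadratic
approximations of arbitrary quality: `(1, ξ)` satisfies T.H. but `(1, ξ, e, e^ξ)` has infinite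
type) — none of those is known to be exponential-algebraic.
[cite: Chudnovsky1984, Ch. 1 Conjecture (PDF p. 26) and PDF p. 36] -/
theorem stub_coreFiniteType :
    ∀ (n : ℕ) (x : Fin n → ℂ), (∀ i, ∃ (m : ℕ) (z : Fin m → ℂ) (f : Fin m → MvPolynomial (Fin m ⊕ Fin m) ℂ), (∃ k, z k = x i) ∧ (∀ k mo, ∃ c : ℤ, (c : ℂ) = (f k).coeff mo) ∧ (∀ k, MvPolynomial.eval (Sum.elim z (Complex.exp ∘ z)) (f k) = 0) ∧ (Matrix.of fun k j => MvPolynomial.eval (Sum.elim z (Complex.exp ∘ z)) (MvPolynomial.pderiv (Sum.inl j) (f k) + MvPolynomial.X (Sum.inr j) * MvPolynomial.pderiv (Sum.inr j) (f k))).det ≠ 0) →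
      ∀ t : ℕ, Algebra.trdeg ℚ ↥(IntermediateField.adjoin ℚ (Set.range x ∪ Set.range (Complex.exp ∘ x))) ≤ (t : Cardinal) →
        ∃ τ : ℝ, τ < (t : ℝ) + 2 ∧ HasTranscendenceType (Sum.elim x (Complex.exp ∘ x)) τ := by
  sorry

/-- Stub **TYPE GAP UNDER T.H.** (the transcendence half): for `n ≥ 1` and a `ℚ`-linearly
independent `x ∈ ℂⁿ` satisfying the Technical Hypothesis, the point `(x, eˣ) ∈ ℂ²ⁿ` has
transcendence type `≥ n + 1`: it does NOT have type `≤ τ` for any `τ < n + 1`. Implied by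
Schanuel's conclusion at `x` (Dirichlet's box principle gives type `≥ trdeg + 1`); the content is
the case `trdeg < n`, where it asserts abnormally small nonzero integer-polynomial values at
`(x, eˣ)` — what an auxiliary function on the separated nodes `{h·x}` produces (T.H. ⇒ zero
estimate). OPEN; `n = 1` is Hermite–Lindemann + Dirichlet.
[cite: NesterenkoPhilippon2001, Ch. 14 Def. 2.6 and Prop. 3.6] -/
theorem stub_typeGapUnderTH :
    ∀ (n : ℕ) (x : Fin n → ℂ), 0 < n → LinearIndependent ℚ x →
      (∀ ε : ℝ, 0 < ε → ∃ H₀ : ℝ, 0 < H₀ ∧ ∀ H : ℝ, H₀ ≤ H → ∀ h : Fin n → ℤ, h ≠ 0 → (∀ i, (|h i| : ℝ) ≤ H) → Real.exp (-H ^ ε) ≤ ‖∑ i, (h i : ℂ) * x i‖) →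
        ∀ τ : ℝ, τ < (n : ℝ) + 1 → ¬ HasTranscendenceType (Sum.elim x (Complex.exp ∘ x)) τ := by
  sorry

/-! ### Stub statements by name -/

namespace Statement

/-- Statement of `stub_coreFiniteType`. -/
abbrev stub_coreFiniteType : Prop := type_of% @Birth.stub_coreFiniteType
/-- Statement of `stub_typeGapUnderTH`. -/
abbrev stub_typeGapUnderTH : Prop := type_of% @Birth.stub_typeGapUnderTH

end Statement

/-! ### Glue: the linear shadow of finite type is the Technical Hypothesis -/

/-- `c · (2 + log (1 + H))^τ ≤ H^ε` for all large `H` (`(log H)^τ = o(H^ε)`). [folklore] -/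
theorem exists_size_bound (c τ ε : ℝ) (hτ : 0 ≤ τ) (hε : 0 < ε) :
    ∃ H₁ : ℝ, 0 < H₁ ∧ ∀ H : ℝ, H₁ ≤ H → c * (2 + Real.log (1 + H)) ^ τ ≤ H ^ ε := by
  set κ : ℝ := 1 / (|c| * (2 : ℝ) ^ τ + 1) with hκ
  have h2τ : 0 ≤ (2 : ℝ) ^ τ := Real.rpow_nonneg (by norm_num) τ
  have hκpos : 0 < κ := by positivity
  obtain ⟨a, ha⟩ := Filter.eventually_atTop.mp ((isLittleO_log_rpow_rpow_atTop τ hε).def hκpos)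
  refine ⟨max a (Real.exp 3), lt_max_of_lt_right (Real.exp_pos 3), fun H hH => ?_⟩
  have haH : a ≤ H := le_of_max_le_left hH
  have heH : Real.exp 3 ≤ H := le_of_max_le_right hH
  have hHpos : 0 < H := (Real.exp_pos 3).trans_le heH
  have hH1 : 1 ≤ H := le_trans (by linarith [Real.add_one_le_exp (3 : ℝ)]) heH
  have hlogH : 3 ≤ Real.log H := by
    rw [Real.le_log_iff_exp_le hHpos]; exact heH
  have h1 : Real.log (1 + H) ≤ 1 + Real.log H := by
    have hexp1 : (2 : ℝ) ≤ Real.exp 1 := by linarith [Real.add_one_le_exp (1 : ℝ)]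
    have h1H : 1 + H ≤ Real.exp 1 * H := by nlinarith
    calc Real.log (1 + H) ≤ Real.log (Real.exp 1 * H) := Real.log_le_log (by linarith) h1H
      _ = 1 + Real.log H := by rw [Real.log_mul (Real.exp_pos 1).ne' hHpos.ne', Real.log_exp]
  have h2 : 2 + Real.log (1 + H) ≤ 2 * Real.log H := by linarith
  have h0 : 0 ≤ 2 + Real.log (1 + H) := by
    have := Real.log_nonneg (by linarith : (1 : ℝ) ≤ 1 + H); linarith
  have hlog0 : 0 ≤ Real.log H := by linarith
  have h3 : (2 + Real.log (1 + H)) ^ τ ≤ (2 * Real.log H) ^ τ := Real.rpow_le_rpow h0 h2 hτ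
  have h4 : (2 * Real.log H) ^ τ = (2 : ℝ) ^ τ * Real.log H ^ τ := Real.mul_rpow (by norm_num) hlog0
  have h5 := ha H haH
  rw [Real.norm_of_nonneg (Real.rpow_nonneg hlog0 τ), Real.norm_of_nonneg (Real.rpow_nonneg hHpos.le ε)] at h5
  have hHε : 0 ≤ H ^ ε := Real.rpow_nonneg hHpos.le ε
  have hcκ : |c| * (2 : ℝ) ^ τ * κ ≤ 1 := by
    rw [hκ, mul_one_div]
    exact (div_le_one (by positivity)).mpr (by linarith)
  calc c * (2 + Real.log (1 + H)) ^ τ ≤ |c| * (2 + Real.log (1 + H)) ^ τ :=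
        mul_le_mul_of_nonneg_right (le_abs_self c) (Real.rpow_nonneg h0 τ)
    _ ≤ |c| * ((2 : ℝ) ^ τ * Real.log H ^ τ) := by
        rw [← h4]; exact mul_le_mul_of_nonneg_left h3 (abs_nonneg c)
    _ ≤ |c| * ((2 : ℝ) ^ τ * (κ * H ^ ε)) := by gcongr
    _ = (|c| * (2 : ℝ) ^ τ * κ) * H ^ ε := by ring
    _ ≤ 1 * H ^ ε := mul_le_mul_of_nonneg_right hcκ hHε
    _ = H ^ ε := one_mul _

/-- A nonzero integer combination of a `ℚ`-linearly independent tuple is nonzero. [folklore] -/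
theorem sum_intCast_mul_ne_zero {n : ℕ} {x : Fin n → ℂ} (hli : LinearIndependent ℚ x)
    {h : Fin n → ℤ} (hh : h ≠ 0) : ∑ i, (h i : ℂ) * x i ≠ 0 := by
  intro hsum
  apply hh
  have key := Fintype.linearIndependent_iff.mp hli (fun i => (h i : ℚ)) (by
    have : ∀ i, ((h i : ℚ)) • x i = (h i : ℂ) * x i := fun i => by
      rw [Rat.smul_def, Rat.cast_intCast]
    simp_rw [this]; exact hsum)
  funext i
  exact_mod_cast key i

/-- The size of the total degree and height of a linear form `∑ hᵢ Xᵢ`: `t ≤ 2 + log(1 + H)` when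
`max |hᵢ| ≤ H`. [folklore] -/
theorem polySize_linear_le {n : ℕ} (h : Fin n → ℤ) {H : ℝ} (hH : 0 ≤ H)
    (hbd : ∀ i, (|h i| : ℝ) ≤ H) :
    polySize (∑ i, MvPolynomial.C (h i) * MvPolynomial.X (Sum.inl i : Fin n ⊕ Fin n)) ≤
      2 + Real.log (1 + H) := by
  classical
  set Q : MvPolynomial (Fin n ⊕ Fin n) ℤ := ∑ i, MvPolynomial.C (h i) * MvPolynomial.X (Sum.inl i)
    with hQdef
  -- total degree ≤ 1
  have hdeg : Q.totalDegree ≤ 1 := by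
    refine MvPolynomial.totalDegree_finsetSum_le fun i _ => ?_
    calc (MvPolynomial.C (h i) * MvPolynomial.X (Sum.inl i : Fin n ⊕ Fin n)).totalDegree
        ≤ (MvPolynomial.C (h i) : MvPolynomial (Fin n ⊕ Fin n) ℤ).totalDegree +
            (MvPolynomial.X (Sum.inl i : Fin n ⊕ Fin n) : MvPolynomial (Fin n ⊕ Fin n) ℤ).totalDegree :=
          MvPolynomial.totalDegree_mul _ _
      _ ≤ 1 := by rw [MvPolynomial.totalDegree_C, MvPolynomial.totalDegree_X]
  -- every coefficient is some `h i` or `0`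
  have hcoeff : ∀ m, ((Q.coeff m).natAbs : ℝ) ≤ H := by
    intro m
    have hcm : Q.coeff m = ∑ i, (if Finsupp.single (Sum.inl i : Fin n ⊕ Fin n) 1 = m then h i else 0) := by
      simp only [hQdef, MvPolynomial.coeff_sum, MvPolynomial.coeff_C_mul, MvPolynomial.coeff_X, mul_ite,
        mul_one, mul_zero]
    by_cases hm : ∃ i, Finsupp.single (Sum.inl i : Fin n ⊕ Fin n) 1 = m
    · obtain ⟨i₀, rfl⟩ := hm
      have hsum : (∑ i, (if Finsupp.single (Sum.inl i : Fin n ⊕ Fin n) 1 =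
          Finsupp.single (Sum.inl i₀ : Fin n ⊕ Fin n) 1 then h i else 0)) = h i₀ := by
        have hiff : ∀ i : Fin n, (Finsupp.single (Sum.inl i : Fin n ⊕ Fin n) 1 =
            Finsupp.single (Sum.inl i₀ : Fin n ⊕ Fin n) 1) ↔ i = i₀ := fun i => by
          rw [Finsupp.single_left_inj one_ne_zero, Sum.inl.injEq]
        simp_rw [hiff]
        simp [Finset.sum_ite_eq']
      rw [hcm, hsum, Nat.cast_natAbs, Int.cast_abs]
      simpa using hbd i₀
    · push Not at hm
      have hzero : Q.coeff (m) = 0 := by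
        rw [hcm]; exact Finset.sum_eq_zero fun i _ => if_neg (hm i)
      rw [hzero]; simpa using hH
  have hheight : (polyHeight Q : ℝ) ≤ H := by
    unfold polyHeight
    refine Finset.sup_induction (p := fun b : ℕ => (b : ℝ) ≤ H) (by simpa using hH) ?_ ?_
    · intro a₁ h₁ a₂ h₂
      rcases le_total a₁ a₂ with hle | hle
      · rwa [sup_eq_right.mpr hle]
      · rwa [sup_eq_left.mpr hle]
    · intro m _; exact hcoeff m
  -- assemble
  have hlog : Real.log (1 + (polyHeight Q : ℝ)) ≤ Real.log (1 + H) :=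
    Real.log_le_log (by positivity) (by linarith)
  have hdeg' : (Q.totalDegree : ℝ) ≤ 1 := by exact_mod_cast hdeg
  unfold polySize
  linarith

/-- `polySize Q ≥ 0` (indeed `≥ 1`). [folklore] -/
theorem polySize_nonneg {σ : Type*} (Q : MvPolynomial σ ℤ) : 0 ≤ polySize Q := by
  unfold polySize
  have : 0 ≤ Real.log (1 + (polyHeight Q : ℝ)) := Real.log_nonneg (by simp)
  positivity

/-- `polySize Q ≥ 1`. [folklore] -/
theorem one_le_polySize {σ : Type*} (Q : MvPolynomial σ ℤ) : 1 ≤ polySize Q := by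
  unfold polySize
  have : 0 ≤ Real.log (1 + (polyHeight Q : ℝ)) := Real.log_nonneg (by simp)
  have : (0 : ℝ) ≤ (Q.totalDegree : ℝ) := by positivity
  linarith

/-- Type of transcendence is monotone in the exponent: type `≤ τ` implies type `≤ τ'` for
`τ ≤ τ'` (the size is `≥ 1`). [folklore] -/
theorem HasTranscendenceType.mono {σ : Type*} {ω : σ → ℂ} {τ τ' : ℝ} (hle : τ ≤ τ')
    (h : HasTranscendenceType ω τ) : HasTranscendenceType ω τ' := by
  obtain ⟨c, hc, hQ⟩ := h
  refine ⟨c, hc, fun Q hne => le_trans ?_ (hQ Q hne)⟩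
  rw [Real.exp_le_exp, neg_le_neg_iff]
  exact mul_le_mul_of_nonneg_left
    (Real.rpow_le_rpow_of_exponent_le (one_le_polySize Q) hle) hc.le

/-- **The linear shadow of finite type is the Technical Hypothesis**: if `(x, eˣ)` has
transcendence type `≤ τ` (`τ ≥ 0`) and `x` is `ℚ`-linearly independent, then `x` satisfies T.H.
in the exact syntactic form of the route (`|h·x| ≥ exp(−c (2 + log(1+H))^τ) ≥ exp(−H^ε)` for
`H ≥ H₀(ε)`). In particular stub CORE FINITE TYPE strengthens crux `THOnExpAlgebraic` from
linear to polynomial forms. [folklore] -/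
theorem th_of_hasTranscendenceType {n : ℕ} {x : Fin n → ℂ} (hli : LinearIndependent ℚ x)
    {τ : ℝ} (hτ : 0 ≤ τ) (hT : HasTranscendenceType (Sum.elim x (Complex.exp ∘ x)) τ) :
    ∀ ε : ℝ, 0 < ε → ∃ H₀ : ℝ, 0 < H₀ ∧ ∀ H : ℝ, H₀ ≤ H → ∀ h : Fin n → ℤ, h ≠ 0 →
      (∀ i, (|h i| : ℝ) ≤ H) → Real.exp (-H ^ ε) ≤ ‖∑ i, (h i : ℂ) * x i‖ := by
  obtain ⟨c, hc, hQ⟩ := hT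
  intro ε hε
  obtain ⟨H₁, hH₁pos, hH₁⟩ := exists_size_bound c τ ε hτ hε
  refine ⟨H₁, hH₁pos, fun H hH h hh hbd => ?_⟩
  have hHpos : 0 < H := hH₁pos.trans_le hH
  set Q : MvPolynomial (Fin n ⊕ Fin n) ℤ := ∑ i, MvPolynomial.C (h i) * MvPolynomial.X (Sum.inl i)
    with hQdef
  have hQeval : MvPolynomial.aeval (Sum.elim x (Complex.exp ∘ x)) Q = ∑ i, (h i : ℂ) * x i := by
    simp [hQdef, map_sum]
  have hne : MvPolynomial.aeval (Sum.elim x (Complex.exp ∘ x)) Q ≠ 0 := by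
    rw [hQeval]; exact sum_intCast_mul_ne_zero hli hh
  have hsize : polySize Q ≤ 2 + Real.log (1 + H) := polySize_linear_le h hHpos.le hbd
  calc Real.exp (-H ^ ε) ≤ Real.exp (-(c * polySize Q ^ τ)) := by
        rw [Real.exp_le_exp, neg_le_neg_iff]
        calc c * polySize Q ^ τ ≤ c * (2 + Real.log (1 + H)) ^ τ :=
              mul_le_mul_of_nonneg_left (Real.rpow_le_rpow (polySize_nonneg Q) hsize hτ) hc.le
          _ ≤ H ^ ε := hH₁ H hH
    _ ≤ ‖MvPolynomial.aeval (Sum.elim x (Complex.exp ∘ x)) Q‖ := hQ Q hne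
    _ = ‖∑ i, (h i : ℂ) * x i‖ := by rw [hQeval]

/-! ### The crux from the stubs (kernel-checked composition, no `sorry`) -/

/-- **The summit from the two stub statements** (honest disclosure: the cut proves Schanuel's
conjecture on the way). By Kirby's PROVED reduction `schanuelConjecture_iff_ecl_empty_holds` it
suffices to treat `ℚ`-linearly independent tuples of the countable core `ecl ∅` (integer Khovanskii
coordinates, `Subring.closure ∅ = ⊥`); for such `x ∈ ℂ^{k+1}` with `trdeg ℚ(x, eˣ) ≤ k`, CORE
FINITE TYPE gives some type `τ < k + 2` (w.l.o.g. `τ ≥ 0`), hence T.H.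
(`th_of_hasTranscendenceType`), and TYPE GAP UNDER T.H. forbids every type `< k + 2` —
contradiction. [folklore] -/
theorem schanuel_of_stubs (h₁ : Statement.stub_coreFiniteType) (h₂ : Statement.stub_typeGapUnderTH) :
    _root_.Schanuel :=
  Literature.NumberTheory.Transcendental.schanuelConjecture_iff_ecl_empty_holds.mpr fun n x hx hli => by
    have hcore : ∀ i, ∃ (m : ℕ) (z : Fin m → ℂ) (f : Fin m → MvPolynomial (Fin m ⊕ Fin m) ℂ),
        (∃ k, z k = x i) ∧ (∀ k mo, ∃ c : ℤ, (c : ℂ) = (f k).coeff mo) ∧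
        (∀ k, MvPolynomial.eval (Sum.elim z (Complex.exp ∘ z)) (f k) = 0) ∧
        (Matrix.of fun k j => MvPolynomial.eval (Sum.elim z (Complex.exp ∘ z))
          (MvPolynomial.pderiv (Sum.inl j) (f k) +
            MvPolynomial.X (Sum.inr j) * MvPolynomial.pderiv (Sum.inr j) (f k))).det ≠ 0 :=
      fun i => by
        obtain ⟨m, z, f, hzi, hcoeff, heval, hdet⟩ := hx i
        exact ⟨m, z, f, hzi,
          fun k mo => Subring.mem_bot.mp (by simpa only [Subring.closure_empty] using hcoeff k mo),
          heval, hdet⟩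
    cases n with
    | zero => simp
    | succ k =>
      by_contra hlt
      push Not at hlt
      have hle : Algebra.trdeg ℚ
          ↥(IntermediateField.adjoin ℚ (Set.range x ∪ Set.range (Complex.exp ∘ x))) ≤ (k : Cardinal) :=
        Order.lt_succ_iff.mp (by rw [Cardinal.succ_natCast, ← Nat.cast_succ]; exact hlt)
      obtain ⟨τ, hτlt, hT⟩ := h₁ (k + 1) x hcore k hle
      -- normalise the exponent to be nonnegative (type is monotone in the exponent)
      have hT' : HasTranscendenceType (Sum.elim x (Complex.exp ∘ x)) (max τ 0) :=
        hT.mono (le_max_left τ 0)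
      have hTH := th_of_hasTranscendenceType hli (le_max_right τ 0) hT'
      have hτ₂ : max τ 0 < ((k + 1 : ℕ) : ℝ) + 1 := by
        push_cast
        exact max_lt (by linarith) (by positivity)
      exact h₂ (k + 1) x (Nat.succ_pos k) hli hTH (max τ 0) hτ₂ hT'

/-- **The crux BY NAME from the two stub statements** (CORE FINITE TYPE → TYPE GAP UNDER T.H. →
`DiophantineCore.SchanuelUnderTH`). [folklore] -/
theorem SchanuelUnderTH_of (h₁ : Statement.stub_coreFiniteType)
    (h₂ : Statement.stub_typeGapUnderTH) : SchanuelUnderTH :=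
  fun n x hli _hTH => schanuel_of_stubs h₁ h₂ n x hli

/-- The crux along this line (route `DiophantineCore` decl, by name), MODULO exactly the two
registered stubs (depends on `sorryAx` only through `stub_*`). [folklore] -/
theorem SchanuelUnderTH_proof : SchanuelUnderTH :=
  SchanuelUnderTH_of stub_coreFiniteType stub_typeGapUnderTH

/-- Stub CORE FINITE TYPE alone already yields the route's crux A `THOnExpAlgebraic` (linear
shadow; `trdeg ℚ(x, eˣ)` is finite as the field is finitely generated). [folklore] -/
theorem thOnExpAlgebraic_of_coreFiniteType (h₁ : Statement.stub_coreFiniteType) : THOnExpAlgebraic := by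
  intro n x hcore hli
  -- the field `ℚ(x, eˣ)` is generated by `2n` elements, so its transcendence degree is `≤ 2n`
  have hfin : Algebra.trdeg ℚ
      ↥(IntermediateField.adjoin ℚ (Set.range x ∪ Set.range (Complex.exp ∘ x))) ≤ ((n + n : ℕ) : Cardinal) := by
    have halg := Literature.NumberTheory.Transcendental.isAlgebraic_adjoin_over_algebraAdjoin
      (F := ℚ) (Set.range x ∪ Set.range (Complex.exp ∘ x))
    refine (Algebra.IsAlgebraic.trdeg_le_cardinalMk (alg := halg) ℚ _).trans ?_
    refine (Cardinal.mk_preimage_of_injective _ _ Subtype.val_injective).trans ?_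
    calc Cardinal.mk ↥(Set.range x ∪ Set.range (Complex.exp ∘ x))
        ≤ Cardinal.mk ↥(Set.range x) + Cardinal.mk ↥(Set.range (Complex.exp ∘ x)) :=
          Cardinal.mk_union_le _ _
      _ ≤ Cardinal.mk (Fin n) + Cardinal.mk (Fin n) :=
          add_le_add Cardinal.mk_range_le Cardinal.mk_range_le
      _ = ((n + n : ℕ) : Cardinal) := by simp
  obtain ⟨τ, -, hT⟩ := h₁ n x hcore (n + n) hfin
  exact th_of_hasTranscendenceType hli (le_max_right τ 0) (hT.mono (le_max_left τ 0))

end Summit.Schanuel.Schanuel.Cruxes.SchanuelUnderTH.Birth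

end
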